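import Summits.ValiantsHypothesis.ValiantsHypothesis.Theorems.GrenetZeonTwoDimCoefficientsDefs

/-!
# `GrenetZeon.DualUnipotentThreeHalves` (stmt-ValiantsHypothesis-24318), successor line `slow_core` (DRAFT @970df9a6f625): the ABSORPTION LEMMA
# — pointwise-SHORT blocks are FREE in power currency (val-idea-31 g4 (3); director-valiant R306 (2)(b) / R309 (2))

Lead prover val-port-2 g3.  For a block-upper one-variable polynomial matrix `M = [[A, G],[0, B]]` (cut `top : Fin m → Prop`: entries from a TOP
column into a BOTTOM row vanish) whose TOP diagonal block is pointwise short (`(M^h) i j = 0` on top × top, i.e. `A^h = 0`), whose entries are affine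
(`s`-degree `≤ 1`) and whose BOTTOM block powers `M^b`, `b ≤ L`, have entries of degree `≤ k` on bottom × bottom, EVERY entry of `M^L` has degree
`≤ k + h`.  Mechanism (PATH DECOMPOSITION at the first top→bottom step): for top `i`, bottom `j`,
`(M^L) i j = Σ_{a<L} Σ_{l top} Σ_{q bottom} (M^a) i l · M l q · (M^{L−1−a}) q j` (`pow_apply_top_bot`), the pure-top factor `(M^a) i l` vanishes for
`a ≥ h`, and the surviving terms have degree `≤ a + 1 + k ≤ h + k`.  So gluing a short wild block (ANY glue `G`) onto a slow block costs an ADDITIVE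
`+h` in the slow-plane budget — never a common RATIO: the ratio knapsack `E(n) = U_{p,k} ⊕ band` (which kills every word/flag/weight-currency
sufficient condition on 24318 — C⁺ dead R304, R2-as-typed contested R307) does NOT lift to powers (E(n) is slow with `k = 0`, three legs, R309 (3)).

* `pow_apply_eq_zero_of_bot_top` (bottom→top entries of every power vanish), `pow_apply_eq_zero_of_top_top` (top×top entries of `M^L` vanish for
  `L ≥ h`), `pow_apply_top_bot` (★ the path decomposition), `totalDegree_pow_apply_le` (crude: degree of `(M^L) i j ≤ L` for affine `M`),
* ★ `absorb` — the lemma, stated EXACTLY as `Lines/slow_core.lean`'s `AbsorbLemma` body (δ-unfolding only), so the line's `stub_absorb` closes BY NAME.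

Honest framing.  A per-agnostic matrix lemma (`--supports stmt-ValiantsHypothesis-24318`); nothing here proves R2ᵖ `HeavyTopSlowLaw`, IRR, RED, S3, the
crux, 8062 or `VP ≠ VNP` — all OPEN / NOT proved.  No definitions, no named facts. [val-idea-31 g4 (3); folklore path counting]
-/

-- single-conjunct layout: Sub = Summit, duplicated namespace component intended (the name is mandated)
set_option linter.dupNamespace false
set_option autoImplicit false

noncomputable section

namespace Summit.ValiantsHypothesis.ValiantsHypothesis.Theorems.GrenetZeon.SlowCore

open MvPolynomial Matrix
open scoped BigOperators

section PathDecomposition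

variable {R : Type*} [CommSemiring R] {m : ℕ} (top : Fin m → Prop) [DecidablePred top] (M : Matrix (Fin m) (Fin m) R)

/-- In a block-upper matrix (no entry from a TOP column into a BOTTOM row), every power has the same shape: `(M^L) i j = 0` for bottom `i`, top `j`.
[folklore] -/
theorem pow_apply_eq_zero_of_bot_top (hbu : ∀ i j, ¬ top i → top j → M i j = 0) :
    ∀ (L : ℕ) (i j : Fin m), ¬ top i → top j → (M ^ L) i j = 0
  | 0, i, j, hi, hj => by
      rw [pow_zero, Matrix.one_apply, if_neg]
      rintro rfl
      exact hi hj
  | L + 1, i, j, hi, hj => by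
      rw [pow_succ, Matrix.mul_apply]
      refine Finset.sum_eq_zero fun q _ => ?_
      by_cases hq : top q
      · rw [pow_apply_eq_zero_of_bot_top hbu L i q hi hq, zero_mul]
      · rw [hbu q j hq hj, mul_zero]

/-- If the top diagonal block is pointwise short (`(M^h) i j = 0` on top × top) then so is every higher power: `(M^L) i j = 0` on top × top for
`L ≥ h` (split `M^L = M^h · M^{L−h}` at an intermediate index: top ones die by hypothesis, bottom ones by `pow_apply_eq_zero_of_bot_top`). [folklore] -/
theorem pow_apply_eq_zero_of_top_top (hbu : ∀ i j, ¬ top i → top j → M i j = 0) {h : ℕ}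
    (hsh : ∀ i j, top i → top j → (M ^ h) i j = 0) {L : ℕ} (hL : h ≤ L) (i j : Fin m) (hi : top i) (hj : top j) :
    (M ^ L) i j = 0 := by
  obtain ⟨d, rfl⟩ := Nat.exists_eq_add_of_le hL
  rw [pow_add, Matrix.mul_apply]
  refine Finset.sum_eq_zero fun q _ => ?_
  by_cases hq : top q
  · rw [hsh i q hi hq, zero_mul]
  · rw [pow_apply_eq_zero_of_bot_top top M hbu d q j hq hj, mul_zero]

/-- ★ **PATH DECOMPOSITION at the first top→bottom step.**  For top `i` and bottom `j`,
`(M^L) i j = Σ_{a<L} Σ_{l top} Σ_{q bottom} (M^a) i l · M l q · (M^{L−1−a}) q j`. [folklore] -/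
theorem pow_apply_top_bot (hbu : ∀ i j, ¬ top i → top j → M i j = 0) :
    ∀ (L : ℕ) (i j : Fin m), top i → ¬ top j →
      (M ^ L) i j = ∑ a ∈ Finset.range L, ∑ l ∈ Finset.univ.filter (fun l => top l),
        ∑ q ∈ Finset.univ.filter (fun q => ¬ top q), (M ^ a) i l * M l q * (M ^ (L - 1 - a)) q j
  | 0, i, j, hi, hj => by
      rw [Finset.sum_range_zero, pow_zero, Matrix.one_apply, if_neg]
      rintro rfl
      exact hj hi
  | L + 1, i, j, hi, hj => by
      -- expand `M^{L+1} = M^L · M` at the LAST step and split the intermediate index `r` into top / bottom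
      rw [pow_succ, Matrix.mul_apply,
        ← Finset.sum_filter_add_sum_filter_not Finset.univ (fun r => top r) (fun r => (M ^ L) i r * M r j)]
      rw [Finset.sum_range_succ, add_comm]
      congr 1
      · -- bottom `r`: induction hypothesis at `(i, r)`, then re-assemble `Σ_{r bottom} (M^{L-1-a}) q r · M r j = (M^{L-a}) q j`
        have hIH : ∀ r ∈ Finset.univ.filter (fun r => ¬ top r), (M ^ L) i r * M r j =
            ∑ a ∈ Finset.range L, ∑ l ∈ Finset.univ.filter (fun l => top l),
              ∑ q ∈ Finset.univ.filter (fun q => ¬ top q), (M ^ a) i l * M l q * ((M ^ (L - 1 - a)) q r * M r j) := by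
          intro r hr
          have hr' : ¬ top r := (Finset.mem_filter.mp hr).2
          rw [pow_apply_top_bot hbu L i r hi hr', Finset.sum_mul]
          refine Finset.sum_congr rfl fun a _ => ?_
          rw [Finset.sum_mul]
          refine Finset.sum_congr rfl fun l _ => ?_
          rw [Finset.sum_mul]
          refine Finset.sum_congr rfl fun q _ => ?_
          ring
        rw [Finset.sum_congr rfl hIH, Finset.sum_comm]
        refine Finset.sum_congr rfl fun a ha => ?_
        rw [Finset.sum_comm]
        refine Finset.sum_congr rfl fun l _ => ?_
        rw [Finset.sum_comm]
        refine Finset.sum_congr rfl fun q hq => ?_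
        have hq' : ¬ top q := (Finset.mem_filter.mp hq).2
        have ha' : a < L := Finset.mem_range.mp ha
        rw [← Finset.mul_sum]
        congr 1
        -- `Σ_{r bottom} (M^{L-1-a}) q r · M r j = (M^{L-1-a} · M) q j` because the top `r` contribute nothing (`q` is bottom)
        have htop0 : ∑ r ∈ Finset.univ.filter (fun r => top r), (M ^ (L - 1 - a)) q r * M r j = 0 :=
          Finset.sum_eq_zero fun r hr => by
            rw [pow_apply_eq_zero_of_bot_top top M hbu _ q r hq' (Finset.mem_filter.mp hr).2, zero_mul]
        have hfull : ∑ r ∈ Finset.univ.filter (fun r => ¬ top r), (M ^ (L - 1 - a)) q r * M r j = (M ^ (L - 1 - a) * M) q j := by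
          rw [Matrix.mul_apply, ← Finset.sum_filter_add_sum_filter_not Finset.univ (fun r => top r), htop0, zero_add]
        have hexp : L - 1 - a + 1 = L + 1 - 1 - a := by omega
        rw [hfull, ← pow_succ, hexp]
      · -- top `r`: this is the `a = L` term (`(M^0) q j = δ_{qj}` and `j` is bottom)
        refine Finset.sum_congr rfl fun l _ => ?_
        rw [Nat.add_sub_cancel, Nat.sub_self, pow_zero]
        rw [Finset.sum_eq_single j]
        · rw [Matrix.one_apply_eq, mul_one]
        · intro q _ hqj
          rw [Matrix.one_apply_ne hqj, mul_zero]
        · intro hjn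
          exact absurd (Finset.mem_filter.mpr ⟨Finset.mem_univ j, hj⟩) hjn

end PathDecomposition

section Degrees

variable {m : ℕ}

/-- Crude degree bound: if every entry of `M` has `s`-degree `≤ 1` then every entry of `M^L` has degree `≤ L`. [folklore] -/
theorem totalDegree_pow_apply_le (M : Matrix (Fin m) (Fin m) (MvPolynomial (Fin 1) ℂ)) (haff : ∀ i j, (M i j).totalDegree ≤ 1) :
    ∀ (L : ℕ) (i j : Fin m), ((M ^ L) i j).totalDegree ≤ L
  | 0, i, j => by
      rw [pow_zero, Matrix.one_apply]
      split_ifs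
      · rw [totalDegree_one]
      · rw [totalDegree_zero]
  | L + 1, i, j => by
      rw [pow_succ, Matrix.mul_apply]
      refine (totalDegree_finsetSum _ _).trans (Finset.sup_le fun q _ => ?_)
      exact (totalDegree_mul _ _).trans (by have := totalDegree_pow_apply_le M haff L i q; have := haff q j; omega)

/-- ★ **THE ABSORPTION LEMMA** (val-idea-31 g4 (3)), stated exactly as `Lines/slow_core.lean :: AbsorbLemma` (δ-unfolding only): block-upper for the
cut `top`, top block pointwise short of index `h`, affine entries, bottom block powers of degree `≤ k` up to the exponent `L` ⇒ every entry of `M^L`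
has degree `≤ k + h`. -/
theorem absorb : ∀ (m : ℕ) (top : Fin m → Prop) [DecidablePred top] (M : Matrix (Fin m) (Fin m) (MvPolynomial (Fin 1) ℂ)) (h k L : ℕ),
    (∀ i j, ¬ top i → top j → M i j = 0) →
    (∀ i j, top i → top j → (M ^ h) i j = 0) →
    (∀ i j, (M i j).totalDegree ≤ 1) →
    (∀ b, b ≤ L → ∀ i j, ¬ top i → ¬ top j → ((M ^ b) i j).totalDegree ≤ k) →
    ∀ i j, ((M ^ L) i j).totalDegree ≤ k + h := by
  intro m top _ M h k L hbu hsh haff hbot i j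
  by_cases hi : top i
  · by_cases hj : top j
    · -- top × top: zero from `h` on, degree `≤ L < h` before
      by_cases hL : h ≤ L
      · rw [pow_apply_eq_zero_of_top_top top M hbu hsh hL i j hi hj, totalDegree_zero]
        exact Nat.zero_le _
      · exact (totalDegree_pow_apply_le M haff L i j).trans (by omega)
    · -- top × bottom: the path decomposition
      rw [pow_apply_top_bot top M hbu L i j hi hj]
      refine (totalDegree_finsetSum _ _).trans (Finset.sup_le fun a ha => ?_)
      refine (totalDegree_finsetSum _ _).trans (Finset.sup_le fun l hl => ?_)
      refine (totalDegree_finsetSum _ _).trans (Finset.sup_le fun q hq => ?_)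
      have hl' : top l := (Finset.mem_filter.mp hl).2
      have hq' : ¬ top q := (Finset.mem_filter.mp hq).2
      have ha' : a < L := Finset.mem_range.mp ha
      by_cases hah : h ≤ a
      · rw [pow_apply_eq_zero_of_top_top top M hbu hsh hah i l hi hl', zero_mul, zero_mul, totalDegree_zero]
        exact Nat.zero_le _
      · have h1 := totalDegree_pow_apply_le M haff a i l
        have h2 := haff l q
        have h3 := hbot (L - 1 - a) (by omega) q j hq' hj
        exact (totalDegree_mul _ _).trans ((Nat.add_le_add (totalDegree_mul _ _) h3).trans (by omega))
  · by_cases hj : top j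
    · rw [pow_apply_eq_zero_of_bot_top top M hbu L i j hi hj, totalDegree_zero]
      exact Nat.zero_le _
    · exact (hbot L le_rfl i j hi hj).trans (Nat.le_add_right _ _)

/-- ★ **THE TOWER STEP (AbsorbLemma′, rev 2)** — the induction step of RED's ledger (crit-7 g3 V25 U1 / P-A2; cf. val-idea-31 g4's Sum-indexed
`PowerSieve.totalDegree_pow_triu_le`): block-upper for the cut `top`, affine entries, TOP block powers of degree `≤ k₁` (window `a ≤ L`, on top × top)
and BOTTOM block powers of degree `≤ k₂` (window `b ≤ L`, on bottom × bottom) ⇒ every entry of `M^L` has degree `≤ k₁ + k₂ + 1`: certificates STACK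
additively along a chain (the glue is crossed at most once, `+1`), never through a common ratio.  `absorb` is the case `k₁ = h − 1` (pointwise short top,
where the top powers vanish from `h` on). -/
theorem absorb_tower (m : ℕ) (top : Fin m → Prop) [DecidablePred top] (M : Matrix (Fin m) (Fin m) (MvPolynomial (Fin 1) ℂ))
    (k₁ k₂ L : ℕ)
    (hbu : ∀ i j, ¬ top i → top j → M i j = 0)
    (haff : ∀ i j, (M i j).totalDegree ≤ 1)
    (htop : ∀ a, a ≤ L → ∀ i j, top i → top j → ((M ^ a) i j).totalDegree ≤ k₁)
    (hbot : ∀ b, b ≤ L → ∀ i j, ¬ top i → ¬ top j → ((M ^ b) i j).totalDegree ≤ k₂) :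
    ∀ i j, ((M ^ L) i j).totalDegree ≤ k₁ + k₂ + 1 := by
  intro i j
  by_cases hi : top i
  · by_cases hj : top j
    · exact (htop L le_rfl i j hi hj).trans (by omega)
    · rw [pow_apply_top_bot top M hbu L i j hi hj]
      refine (totalDegree_finsetSum _ _).trans (Finset.sup_le fun a ha => ?_)
      refine (totalDegree_finsetSum _ _).trans (Finset.sup_le fun l hl => ?_)
      refine (totalDegree_finsetSum _ _).trans (Finset.sup_le fun q hq => ?_)
      have hl' : top l := (Finset.mem_filter.mp hl).2
      have hq' : ¬ top q := (Finset.mem_filter.mp hq).2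
      have ha' : a < L := Finset.mem_range.mp ha
      have h1 := htop a (by omega) i l hi hl'
      have h2 := haff l q
      have h3 := hbot (L - 1 - a) (by omega) q j hq' hj
      exact (totalDegree_mul _ _).trans ((Nat.add_le_add (totalDegree_mul _ _) h3).trans (by omega))
  · by_cases hj : top j
    · rw [pow_apply_eq_zero_of_bot_top top M hbu L i j hi hj, totalDegree_zero]
      exact Nat.zero_le _
    · exact (hbot L le_rfl i j hi hj).trans (by omega)

end Degrees

/-! ## §3 (rev 3) CHAINS: per-level window certificates stack along a block-upper LEVEL structure (the ledger's core) -/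

section Chain

variable {R : Type*} [CommSemiring R] {m : ℕ} (lvl : Fin m → ℕ) (M : Matrix (Fin m) (Fin m) R)

/-- With a LEVEL function (`M i j = 0` whenever `lvl i < lvl j`: paths never climb), no power climbs either. [folklore] -/
theorem pow_apply_eq_zero_of_lvl_lt (hbu : ∀ i j, lvl i < lvl j → M i j = 0) :
    ∀ (L : ℕ) (i j : Fin m), lvl i < lvl j → (M ^ L) i j = 0
  | 0, i, j, hij => by
      rw [pow_zero, Matrix.one_apply, if_neg]
      rintro rfl
      exact lt_irrefl _ hij
  | L + 1, i, j, hij => by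
      rw [pow_succ, Matrix.mul_apply]
      refine Finset.sum_eq_zero fun q _ => ?_
      by_cases hq : lvl i < lvl q
      · rw [pow_apply_eq_zero_of_lvl_lt hbu L i q hq, zero_mul]
      · rw [hbu q j (by omega), mul_zero]

/-- ★ **FIRST-DROP DECOMPOSITION.**  For `lvl j < lvl i`:
`(M^L) i j = Σ_{a<L} Σ_{l : lvl l = lvl i} Σ_{q : lvl q < lvl i} (M^a) i l · M l q · (M^{L−1−a}) q j`. [folklore] -/
theorem pow_apply_drop (hbu : ∀ i j, lvl i < lvl j → M i j = 0) :
    ∀ (L : ℕ) (i j : Fin m), lvl j < lvl i →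
      (M ^ L) i j = ∑ a ∈ Finset.range L, ∑ l ∈ Finset.univ.filter (fun l => lvl l = lvl i),
        ∑ q ∈ Finset.univ.filter (fun q => lvl q < lvl i), (M ^ a) i l * M l q * (M ^ (L - 1 - a)) q j
  | 0, i, j, hij => by
      rw [Finset.sum_range_zero, pow_zero, Matrix.one_apply, if_neg]
      rintro rfl
      exact lt_irrefl _ hij
  | L + 1, i, j, hij => by
      -- expand at the LAST step; indices `r` above `i`'s level contribute nothing, same-level `r` give the `a = L` term,
      -- lower `r` are re-assembled with the induction hypothesis
      have hsplit : (M ^ (L + 1)) i j =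
          ∑ r ∈ Finset.univ.filter (fun r => lvl r = lvl i), (M ^ L) i r * M r j +
          ∑ r ∈ Finset.univ.filter (fun r => lvl r < lvl i), (M ^ L) i r * M r j := by
        rw [pow_succ, Matrix.mul_apply,
          ← Finset.sum_filter_add_sum_filter_not Finset.univ (fun r => lvl r < lvl i) (fun r => (M ^ L) i r * M r j),
          add_comm]
        congr 1
        rw [← Finset.sum_filter_add_sum_filter_not (Finset.univ.filter fun r => ¬ lvl r < lvl i) (fun r => lvl r = lvl i)]
        have hzero : ∑ r ∈ (Finset.univ.filter fun r => ¬ lvl r < lvl i).filter (fun r => ¬ lvl r = lvl i),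
            (M ^ L) i r * M r j = 0 := by
          refine Finset.sum_eq_zero fun r hr => ?_
          simp only [Finset.mem_filter, Finset.mem_univ, true_and] at hr
          rw [pow_apply_eq_zero_of_lvl_lt lvl M hbu L i r (by omega), zero_mul]
        rw [hzero, add_zero]
        refine Finset.sum_congr ?_ fun _ _ => rfl
        ext r
        simp only [Finset.mem_filter, Finset.mem_univ, true_and]
        constructor
        · rintro ⟨_, h⟩; exact h
        · intro h; exact ⟨by omega, h⟩
      rw [hsplit, Finset.sum_range_succ, add_comm]
      congr 1
      · -- lower `r`
        have hIH : ∀ r ∈ Finset.univ.filter (fun r => lvl r < lvl i), (M ^ L) i r * M r j =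
            ∑ a ∈ Finset.range L, ∑ l ∈ Finset.univ.filter (fun l => lvl l = lvl i),
              ∑ q ∈ Finset.univ.filter (fun q => lvl q < lvl i), (M ^ a) i l * M l q * ((M ^ (L - 1 - a)) q r * M r j) := by
          intro r hr
          have hr' : lvl r < lvl i := (Finset.mem_filter.mp hr).2
          rw [pow_apply_drop hbu L i r hr', Finset.sum_mul]
          refine Finset.sum_congr rfl fun a _ => ?_
          rw [Finset.sum_mul]
          refine Finset.sum_congr rfl fun l _ => ?_
          rw [Finset.sum_mul]
          refine Finset.sum_congr rfl fun q _ => ?_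
          ring
        rw [Finset.sum_congr rfl hIH, Finset.sum_comm]
        refine Finset.sum_congr rfl fun a ha => ?_
        rw [Finset.sum_comm]
        refine Finset.sum_congr rfl fun l _ => ?_
        rw [Finset.sum_comm]
        refine Finset.sum_congr rfl fun q hq => ?_
        have hq' : lvl q < lvl i := (Finset.mem_filter.mp hq).2
        have ha' : a < L := Finset.mem_range.mp ha
        rw [← Finset.mul_sum]
        congr 1
        have hhigh : ∑ r ∈ Finset.univ.filter (fun r => ¬ lvl r < lvl i), (M ^ (L - 1 - a)) q r * M r j = 0 :=
          Finset.sum_eq_zero fun r hr => by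
            rw [pow_apply_eq_zero_of_lvl_lt lvl M hbu _ q r (by have := (Finset.mem_filter.mp hr).2; omega), zero_mul]
        have hfull : ∑ r ∈ Finset.univ.filter (fun r => lvl r < lvl i), (M ^ (L - 1 - a)) q r * M r j =
            (M ^ (L - 1 - a) * M) q j := by
          rw [Matrix.mul_apply, ← Finset.sum_filter_add_sum_filter_not Finset.univ (fun r => lvl r < lvl i), hhigh,
            add_zero]
        have hexp : L - 1 - a + 1 = L + 1 - 1 - a := by omega
        rw [hfull, ← pow_succ, hexp]
      · -- same-level `r`: the `a = L` term
        refine Finset.sum_congr rfl fun l _ => ?_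
        rw [Nat.add_sub_cancel, Nat.sub_self, pow_zero]
        rw [Finset.sum_eq_single j]
        · rw [Matrix.one_apply_eq, mul_one]
        · intro q _ hqj
          rw [Matrix.one_apply_ne hqj, mul_zero]
        · intro hjn
          exact absurd (Finset.mem_filter.mpr ⟨Finset.mem_univ j, hij⟩) hjn

end Chain

section ChainDegrees

variable {m : ℕ}

/-- ★ **CHAIN ABSORPTION (the ledger's core).**  Let `M` respect a LEVEL function (`M i j = 0` for `lvl i < lvl j`), have affine entries, and carry a
WINDOW certificate `k ℓ` on each level (`deg (M^b) i j ≤ k (lvl i)` for `lvl i = lvl j`, all `b ≤ L`).  Then for `lvl j ≤ lvl i` and `b ≤ L`: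
`deg (M^b) i j ≤ Σ_{lvl j ≤ ℓ ≤ lvl i} k ℓ + (lvl i − lvl j)` — certificates STACK additively down a chain, `+1` per glue crossing.  (`absorb_tower` is the
two-level case; iterate = idea-31 g4's `Σ kᵢ + (t−1)`; the «ShortMassLedger» core of the MASS CUT, director R315 (3).) -/
theorem absorb_chain (lvl : Fin m → ℕ) (M : Matrix (Fin m) (Fin m) (MvPolynomial (Fin 1) ℂ)) (k : ℕ → ℕ) (L : ℕ)
    (hbu : ∀ i j, lvl i < lvl j → M i j = 0)
    (haff : ∀ i j, (M i j).totalDegree ≤ 1)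
    (hk : ∀ b, b ≤ L → ∀ i j, lvl i = lvl j → ((M ^ b) i j).totalDegree ≤ k (lvl i)) :
    ∀ (d b : ℕ), b ≤ L → ∀ i j, lvl j + d = lvl i →
      ((M ^ b) i j).totalDegree ≤ ∑ ℓ ∈ Finset.Icc (lvl j) (lvl i), k ℓ + (lvl i - lvl j) := by
  intro d
  induction d using Nat.strong_induction_on with
  | _ d ih =>
    intro b hb i j hd
    rcases Nat.eq_zero_or_pos d with rfl | hdpos
    · -- same level
      have hij : lvl i = lvl j := by omega
      have := hk b hb i j hij
      rw [hij, Finset.Icc_self, Finset.sum_singleton, Nat.sub_self, add_zero]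
      rw [hij] at this
      exact this
    · -- `lvl j < lvl i`: first-drop decomposition
      have hij : lvl j < lvl i := by omega
      rw [pow_apply_drop lvl M hbu b i j hij]
      refine (totalDegree_finsetSum _ _).trans (Finset.sup_le fun a ha => ?_)
      refine (totalDegree_finsetSum _ _).trans (Finset.sup_le fun l hl => ?_)
      refine (totalDegree_finsetSum _ _).trans (Finset.sup_le fun q hq => ?_)
      have hl' : lvl l = lvl i := (Finset.mem_filter.mp hl).2
      have hq' : lvl q < lvl i := (Finset.mem_filter.mp hq).2
      have ha' : a < b := Finset.mem_range.mp ha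
      by_cases hqj : lvl q < lvl j
      · rw [pow_apply_eq_zero_of_lvl_lt lvl M hbu _ q j hqj, mul_zero, totalDegree_zero]
        exact Nat.zero_le _
      · have h1 : ((M ^ a) i l).totalDegree ≤ k (lvl i) := hk a (by omega) i l hl'.symm
        have h2 := haff l q
        have h3 : ((M ^ (b - 1 - a)) q j).totalDegree ≤ ∑ ℓ ∈ Finset.Icc (lvl j) (lvl q), k ℓ + (lvl q - lvl j) :=
          ih (lvl q - lvl j) (by omega) (b - 1 - a) (by omega) q j (by omega)
        have hsub : ∑ ℓ ∈ Finset.Icc (lvl j) (lvl q), k ℓ + k (lvl i) ≤ ∑ ℓ ∈ Finset.Icc (lvl j) (lvl i), k ℓ := by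
          have hss : insert (lvl i) (Finset.Icc (lvl j) (lvl q)) ⊆ Finset.Icc (lvl j) (lvl i) := by
            intro ℓ hℓ
            rw [Finset.mem_insert, Finset.mem_Icc] at hℓ
            rw [Finset.mem_Icc]
            omega
          have hni : lvl i ∉ Finset.Icc (lvl j) (lvl q) := by rw [Finset.mem_Icc]; omega
          calc ∑ ℓ ∈ Finset.Icc (lvl j) (lvl q), k ℓ + k (lvl i) = ∑ ℓ ∈ insert (lvl i) (Finset.Icc (lvl j) (lvl q)), k ℓ := by
                rw [Finset.sum_insert hni, add_comm]
            _ ≤ ∑ ℓ ∈ Finset.Icc (lvl j) (lvl i), k ℓ := Finset.sum_le_sum_of_subset hss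
        calc ((M ^ a) i l * M l q * (M ^ (b - 1 - a)) q j).totalDegree
            ≤ ((M ^ a) i l * M l q).totalDegree + ((M ^ (b - 1 - a)) q j).totalDegree := totalDegree_mul _ _
          _ ≤ (k (lvl i) + 1) + (∑ ℓ ∈ Finset.Icc (lvl j) (lvl q), k ℓ + (lvl q - lvl j)) :=
              Nat.add_le_add ((totalDegree_mul _ _).trans (Nat.add_le_add h1 h2)) h3
          _ ≤ ∑ ℓ ∈ Finset.Icc (lvl j) (lvl i), k ℓ + (lvl i - lvl j) := by omega

/-- **Uniform form**: with `t` levels and `K = Σ_{ℓ<t} k ℓ`, every entry of every power `b ≤ L` has degree `≤ K + (t − 1)` (entries above the level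
structure vanish). -/
theorem absorb_chain_uniform (lvl : Fin m → ℕ) (M : Matrix (Fin m) (Fin m) (MvPolynomial (Fin 1) ℂ)) (k : ℕ → ℕ) (L t : ℕ)
    (hlvl : ∀ i, lvl i < t)
    (hbu : ∀ i j, lvl i < lvl j → M i j = 0)
    (haff : ∀ i j, (M i j).totalDegree ≤ 1)
    (hk : ∀ b, b ≤ L → ∀ i j, lvl i = lvl j → ((M ^ b) i j).totalDegree ≤ k (lvl i)) :
    ∀ b, b ≤ L → ∀ i j, ((M ^ b) i j).totalDegree ≤ ∑ ℓ ∈ Finset.range t, k ℓ + (t - 1) := by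
  intro b hb i j
  by_cases hij : lvl i < lvl j
  · rw [pow_apply_eq_zero_of_lvl_lt lvl M hbu b i j hij, totalDegree_zero]
    exact Nat.zero_le _
  · have h := absorb_chain lvl M k L hbu haff hk (lvl i - lvl j) b hb i j (by omega)
    have hss : Finset.Icc (lvl j) (lvl i) ⊆ Finset.range t := by
      intro ℓ hℓ; rw [Finset.mem_Icc] at hℓ; rw [Finset.mem_range]; have := hlvl i; omega
    have hs := Finset.sum_le_sum_of_subset (f := k) hss
    have := hlvl i
    omega

end ChainDegrees

end Summit.ValiantsHypothesis.ValiantsHypothesis.Theorems.GrenetZeon.SlowCore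

end
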